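import Literature.AlgebraicGeometry.HodgeTheory.SemiregularVariationalHodgeTwistedPerfect
import Literature.AlgebraicGeometry.HodgeTheory.ISemiregularOfSchemeIso
import Literature.AlgebraicGeometry.HodgeTheory.IsoTransport
import HarnessLib

/-!
# The object class of `B`-twisted admissible perfect complexes is invariant under isomorphisms of the
# ambient `ℂ`-scheme, for every admissibility notion that is — and Buchweitz–Flenner's notion is

Layer `Literature/AlgebraicGeometry/HodgeTheory`. THEOREMS ONLY (no definition, no named fact; D-0026). Requested by road
b02 (`Summits/HodgeConjecture/HodgeConjecture/Theses/VHCAbelianSchemesRoad.lean`, crux stmt-HodgeConjecture-19787): several of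
its kernel theorems DISPLAY the hypothesis «the door `twistedReflexiveClass C Adm` respects isomorphisms»
(`∀ n ⦃Y Y'⦄ (e : Y' ≅ Y) I κ, 𝒪 n Y I κ → 𝒪 n Y' I (fun q ↦ e^* (κ q))`), which is bookkeeping, not mathematics:
the datum `(E•, B₀)` of Perry's Thm. 1.1 on `X₀` pulls back along an isomorphism `e : X₀' ≅ X₀` to the datum
`(e^* E•, e^* B₀)` with classes `e^*(exp(B₀) ∪ ch(E•)) = exp(e^* B₀) ∪ ch(e^* E•)`. This file proves exactly that, with the
admissibility (semiregularity) notion `Adm` — the SCHEMA PARAMETER of `SemiregularVariationalHodgeTwistedPerfect.lean` — as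
the only thing whose invariance must be supplied:

* §1 `map_expTwistClasses` — naturality of the `B`-twist under pull-back: `f^*((exp(B) ∪ κ)_k) = (exp(f^*B) ∪ f^*κ)_k`
  (`f^*` is a ring map: Hatcher Prop. 3.10; any morphism `f`).
* §2 `twistedReflexiveClass.of_schemeIso` — for `e : Y' ≅ Y` and a notion `Adm` whose admissible bounded complexes of
  vector bundles on `Y` pull back to admissible ones on `Y'` (hypothesis `hAdm`, stated for the term-wise pull-back
  `(Scheme.Modules.pullback e.hom.left).mapHomologicalComplex _`), membership transports: `κ ↦ (e^* κ_p)_p`. Witness: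
  `(e^* E•, e^* B₀)` — bounded of vector bundles (`IsBoundedVBComplex.pullback`), `e^* B₀` rational and algebraic
  (`IsoTransport`), classes by §1 and `map_chPerfect` (`ch ∘ f^* = f^* ∘ ch`, Fulton §15.1 (ii)). Packaged in the road's
  displayed shape: `twistedReflexiveClass_respectsIso_of_adm`.
* §3 `bfSingleAdmissible.pullback_of_schemeIso` — Buchweitz–Flenner's notion (an `I`-semiregular vector bundle placed in
  degree `0`) IS invariant: the pull-back complex is again concentrated in degree `0` (`e^*` preserves zero objects) and its
  degree-`0` term `e^* E⁰ ≅ e^* F ≅ (e⁻¹)_* F` (`pullbackInvIsoPushforward`) has the `I`-semiregular model `(e⁻¹)_* F`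
  (`IsISemiregular.of_schemeIso`: «`ℰ_0` is called `I`-semiregular if the part `σ_I` of the semiregularity map is injective»
  is a property of the pair `(X₀, ℰ_0)` up to isomorphism). Hence (§4) the door `twistedReflexiveClass C bfSingleAdmissible`
  respects isomorphisms UNCONDITIONALLY, and so does `twistedReflexiveClass C (P ∨ bfSingleAdmissible)` for every notion `P`
  that is invariant (`twistedReflexiveClass_respectsIso_or_bfSingle`) — the road's `AdmTw := gluableSigmaAdmissible ∨
  bfSingleAdmissible` is of this shape, with `P` the venture's σ-notion for strictly perfect complexes (whose invariance —
  `Ext`-ranks in `D(Mod 𝒪_X)` and the complex-level `σ_q` along `e_*` — is NOT proved here: summit-side it stays ONE displayed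
  notion-level hypothesis).

Nothing here asserts any variational statement; no declaration of another file is touched.

References: [Perry2026Semiregularity] A. Perry, arXiv:2604.00511, Thm. 1.1 (the datum `(E_0, B_0)`, `w_0 = exp(B_0)·ch(E_0)`);
[HuybrechtsStellari2005] D. Huybrechts, P. Stellari, §1 (`ch^B = ch · exp(B)`); [HatcherAT2002] A. Hatcher, *Algebraic Topology*,
Prop. 3.10 (naturality of cup product); [Fulton1998] W. Fulton, *Intersection Theory*, §15.1 (ii); [BuchweitzFlenner2003]
R.-O. Buchweitz, H. Flenner, Compositio Math. 137 (2003), Def. 4.1 and §5 (`I`-semiregular).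
-/

noncomputable section

open CategoryTheory CategoryTheory.Limits AlgebraicGeometry
open AlgebraicGeometry.Scheme.Modules
open Literature.AlgebraicTopology.SingularHomology
open Literature.AlgebraicGeometry.KTheory

namespace Literature.AlgebraicGeometry.HodgeTheory

open Literature.AlgebraicGeometry.Motives Literature.AlgebraicGeometry.Modules

/-! ### §1 Naturality of the `B`-twist under pull-back -/

section ExpTwist

variable {X Y : SchemeOver ℂ}

/-- **Naturality of the `B`-twist**: `f^*((exp(B) ∪ κ)_k) = (exp(f^*B) ∪ (f^*κ))_k` for a `ℂ`-morphism `f : Y ⟶ X`,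
a class `B ∈ H²(X(ℂ); ℂ)` and classes `κ_j ∈ H^{2j}(X(ℂ); ℂ)` — `f^*` is a `ℂ`-algebra map on cohomology (naturality of the
cup product and of cup powers). [cite: HatcherAT2002, Prop. 3.10] [cite: HuybrechtsStellari2005, §1 (twisted Chern character)] -/
theorem map_expTwistClasses (f : Y ⟶ X) (B : complexBetti X 2) (κ : (j : ℕ) → complexBetti X (2 * j)) (k : ℕ) :
    complexBetti.map f (2 * k) (expTwistClasses X B κ k) =
      expTwistClasses Y (complexBetti.map f 2 B) (fun j => complexBetti.map f (2 * j) (κ j)) k := by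
  unfold expTwistClasses
  rw [map_sum]
  refine Finset.sum_congr rfl fun i _ => ?_
  have hcup := cupProduct_map (R := ℂ) (Motives.AlgPoints.mapContinuous (L := ℂ) f)
    (two_mul_add_two_mul_sub i.2) (cupPowTwo B i) (κ (k - i))
  have hpow := map_cupPowTwo (Motives.AlgPoints.mapContinuous (L := ℂ) f) B i
  rw [(complexBetti.map f (2 * k)).hom.map_smul]
  dsimp only
  rw [← hpow, ← hcup]

end ExpTwist

/-! ### §2 The object class transports along isomorphisms whenever the admissibility notion does -/

section ObjectClass

variable {C : ChernCharacterBetti} {Adm : PerfectAdmissibility} {n : ℕ} {Y Y' : SchemeOver ℂ}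

/-- **`twistedReflexiveClass C Adm` is invariant under an isomorphism `e : Y' ≅ Y` of `ℂ`-schemes, for every notion `Adm`
whose admissible bounded complexes of vector bundles on `Y` pull back (term-wise along `e`) to admissible complexes on `Y'`**
(hypothesis `hAdm`): if `κ` is the `B₀`-twisted Chern character, in the degrees `I`, of an admissible `E•` on `Y`, then
`(e^* κ_p)_p` is that of `(e^* E•, e^* B₀)` on `Y'` — `e^* B₀` is rational and algebraic, and
`e^*(exp(B₀) ∪ ch(E•)) = exp(e^* B₀) ∪ ch(e^* E•)` (`map_expTwistClasses`, `map_chPerfect`). Perry's datum `(E_0, B_0)` is a datum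
on the isomorphism class of `X_0`. [cite: Perry2026Semiregularity, Thm. 1.1 (hypotheses)] [cite: Fulton1998, §15.1 (ii)] -/
theorem twistedReflexiveClass.of_schemeIso (e : Y' ≅ Y) {I : Finset ℕ} {κ : (p : ℕ) → complexBetti Y (2 * p)}
    (hAdm : ∀ (E : CochainComplex Y.left.Modules ℤ), IsBoundedVBComplex E → Adm n Y I E →
      Adm n Y' I (((Scheme.Modules.pullback e.hom.left).mapHomologicalComplex _).obj E))
    (h : twistedReflexiveClass C Adm n Y I κ) :
    twistedReflexiveClass C Adm n Y' I (fun p => complexBetti.map e.hom (2 * p) (κ p)) := by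
  obtain ⟨E, hE, B₀, hA, hBr, hBa, hκ⟩ := h
  refine ⟨((Scheme.Modules.pullback e.hom.left).mapHomologicalComplex _).obj E, hE.pullback e.hom.left,
    complexBetti.map e.hom 2 B₀, hAdm E hE hA, hBr.pullback _, (mem_algebraicClasses_map_iff_of_iso e).2 hBa,
    fun p hp => ?_⟩
  change complexBetti.map e.hom (2 * p) (κ p) = _
  rw [hκ p hp, map_expTwistClasses]
  congr 1
  funext j
  exact map_chPerfect C Y e.hom hE j

variable (C Adm) in
/-- **The road's displayed shape**: if the notion `Adm` is invariant under pull-back along isomorphisms of `ℂ`-schemes (on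
bounded complexes of vector bundles), then the door `twistedReflexiveClass C Adm` RESPECTS ISOMORPHISMS —
`∀ n ⦃Y Y'⦄ (e : Y' ≅ Y) I κ, 𝒪 n Y I κ → 𝒪 n Y' I (fun q ↦ e^*(κ q))` for `𝒪 := twistedReflexiveClass C Adm`, verbatim the
hypothesis `h𝒪`/`hresp` of the road's kernel theorems. [cite: Perry2026Semiregularity, Thm. 1.1 (hypotheses)] [cite: Fulton1998, §15.1 (ii)] -/
theorem twistedReflexiveClass_respectsIso_of_adm
    (hAdm : ∀ (n : ℕ) ⦃Y Y' : SchemeOver ℂ⦄ (e : Y' ≅ Y) (I : Finset ℕ) (E : CochainComplex Y.left.Modules ℤ),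
      IsBoundedVBComplex E → Adm n Y I E →
        Adm n Y' I (((Scheme.Modules.pullback e.hom.left).mapHomologicalComplex _).obj E)) :
    ∀ (n : ℕ) ⦃Y Y' : SchemeOver ℂ⦄ (e : Y' ≅ Y) (I : Finset ℕ) (κ : (q : ℕ) → complexBetti Y (2 * q)),
      twistedReflexiveClass C Adm n Y I κ →
        twistedReflexiveClass C Adm n Y' I (fun q => complexBetti.map e.hom (2 * q) (κ q)) :=
  fun n _ _ e I _ h => h.of_schemeIso e (hAdm n e I)

end ObjectClass

/-! ### §3 Buchweitz–Flenner's notion is invariant under isomorphisms of the ambient scheme -/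

section BF

variable {n : ℕ} {Y Y' : SchemeOver ℂ}

/-- **`bfSingleAdmissible` is invariant under pull-back along an isomorphism `e : Y' ≅ Y` of `ℂ`-schemes.** If `E•` on `Y`
has zero terms off degree `0` and `E⁰ ≅ F` with `F` finite locally free and `I`-semiregular
(`(σ_q)_{q+1 ∈ I}` jointly injective), then the term-wise pull-back `e^* E•` has zero terms off degree `0` (`e^*` preserves zero
objects) and `(e^* E•)⁰ = e^* E⁰ ≅ e^* F ≅ (e⁻¹)_* F` (`pullbackInvIsoPushforward`), where `(e⁻¹)_* F` is finite locally free and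
`I`-semiregular by the isomorphism-invariance of Buchweitz–Flenner semiregularity (`IsISemiregular.of_schemeIso`).
[cite: BuchweitzFlenner2003, Def. 4.1 and §5 (I-semiregular); reading: σ_I is intrinsic to (X₀, ℰ_0) up to isomorphism] -/
theorem bfSingleAdmissible.pullback_of_schemeIso (e : Y' ≅ Y) {I : Finset ℕ} {E : CochainComplex Y.left.Modules ℤ}
    (h : bfSingleAdmissible n Y I E) :
    bfSingleAdmissible n Y' I (((Scheme.Modules.pullback e.hom.left).mapHomologicalComplex _).obj E) := by
  have h' : (∀ i : ℤ, i ≠ 0 → IsZero (E.X i)) ∧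
      ∃ (F : Y.left.Modules) (hF : IsFiniteLocallyFree F), Nonempty (E.X 0 ≅ F) ∧ IsISemiregular hF {q | q + 1 ∈ I} := h
  obtain ⟨h0, F, hF, ⟨iF⟩, hsr⟩ := h'
  refine ⟨fun i hi => (Scheme.Modules.pullback e.hom.left).map_isZero (h0 i hi),
    (pushforward e.inv.left).obj F, hF.pushforward_of_iso (leftIso' e.symm), ⟨?_⟩,
    IsISemiregular.of_schemeIso e.symm hF hsr⟩
  exact (Scheme.Modules.pullback e.hom.left).mapIso iF ≪≫ pullbackInvIsoPushforward (leftIso' e.symm) F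

/-- The displayed shape for Buchweitz–Flenner's notion: `bfSingleAdmissible` is invariant under pull-back along every
isomorphism of `ℂ`-schemes (no hypothesis). [cite: BuchweitzFlenner2003, §5 (I-semiregular)] -/
theorem bfSingleAdmissible_pullback_of_schemeIso :
    ∀ (n : ℕ) ⦃Y Y' : SchemeOver ℂ⦄ (e : Y' ≅ Y) (I : Finset ℕ) (E : CochainComplex Y.left.Modules ℤ),
      IsBoundedVBComplex E → bfSingleAdmissible n Y I E →
        bfSingleAdmissible n Y' I (((Scheme.Modules.pullback e.hom.left).mapHomologicalComplex _).obj E) :=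
  fun _ _ _ e _ _ _ h => h.pullback_of_schemeIso e

end BF

/-! ### §4 Consequences: the Buchweitz–Flenner door, and doors `P ∨ bfSingleAdmissible` -/

section Doors

variable (C : ChernCharacterBetti)

/-- **The door `twistedReflexiveClass C bfSingleAdmissible` (Perry's datum with a Buchweitz–Flenner `I`-semiregular vector
bundle) RESPECTS ISOMORPHISMS of `ℂ`-schemes, unconditionally.** [cite: BuchweitzFlenner2003, §5 (I-semiregular)]
[cite: Perry2026Semiregularity, Thm. 1.1 (hypotheses)] -/
theorem twistedReflexiveClass_bfSingle_respectsIso :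
    ∀ (n : ℕ) ⦃Y Y' : SchemeOver ℂ⦄ (e : Y' ≅ Y) (I : Finset ℕ) (κ : (q : ℕ) → complexBetti Y (2 * q)),
      twistedReflexiveClass C bfSingleAdmissible n Y I κ →
        twistedReflexiveClass C bfSingleAdmissible n Y' I (fun q => complexBetti.map e.hom (2 * q) (κ q)) :=
  twistedReflexiveClass_respectsIso_of_adm C bfSingleAdmissible bfSingleAdmissible_pullback_of_schemeIso

variable {P : PerfectAdmissibility}

/-- **A disjunction `P ∨ bfSingleAdmissible` is invariant under pull-back along isomorphisms as soon as `P` is** — the shape of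
the road's `AdmTw := gluableSigmaAdmissible ∨ bfSingleAdmissible` (with `P` the venture's σ-notion for strictly perfect complexes,
whose invariance is the one input left). [cite: BuchweitzFlenner2003, §5 (I-semiregular)] -/
theorem or_bfSingleAdmissible_pullback_of_schemeIso
    (hP : ∀ (n : ℕ) ⦃Y Y' : SchemeOver ℂ⦄ (e : Y' ≅ Y) (I : Finset ℕ) (E : CochainComplex Y.left.Modules ℤ),
      IsBoundedVBComplex E → P n Y I E → P n Y' I (((Scheme.Modules.pullback e.hom.left).mapHomologicalComplex _).obj E)) :
    ∀ (n : ℕ) ⦃Y Y' : SchemeOver ℂ⦄ (e : Y' ≅ Y) (I : Finset ℕ) (E : CochainComplex Y.left.Modules ℤ),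
      IsBoundedVBComplex E → (P n Y I E ∨ bfSingleAdmissible n Y I E) →
        (P n Y' I (((Scheme.Modules.pullback e.hom.left).mapHomologicalComplex _).obj E) ∨
          bfSingleAdmissible n Y' I (((Scheme.Modules.pullback e.hom.left).mapHomologicalComplex _).obj E)) :=
  fun n _ _ e I E hE h => h.imp (hP n e I E hE) fun hbf => hbf.pullback_of_schemeIso e

/-- **The door `twistedReflexiveClass C (P ∨ bfSingleAdmissible)` RESPECTS ISOMORPHISMS as soon as the notion `P` is invariant
under pull-back along isomorphisms of `ℂ`-schemes** (on bounded complexes of vector bundles) — for the road's twisted door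
`AdmTw` this reduces its displayed hypothesis `h𝒪`/`hresp` to that ONE notion-level statement about the σ-notion.
[cite: Perry2026Semiregularity, Thm. 1.1 (hypotheses)] [cite: BuchweitzFlenner2003, §5 (I-semiregular)] -/
theorem twistedReflexiveClass_respectsIso_or_bfSingle
    (hP : ∀ (n : ℕ) ⦃Y Y' : SchemeOver ℂ⦄ (e : Y' ≅ Y) (I : Finset ℕ) (E : CochainComplex Y.left.Modules ℤ),
      IsBoundedVBComplex E → P n Y I E → P n Y' I (((Scheme.Modules.pullback e.hom.left).mapHomologicalComplex _).obj E)) :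
    ∀ (n : ℕ) ⦃Y Y' : SchemeOver ℂ⦄ (e : Y' ≅ Y) (I : Finset ℕ) (κ : (q : ℕ) → complexBetti Y (2 * q)),
      twistedReflexiveClass C (fun n X₀ I E => P n X₀ I E ∨ bfSingleAdmissible n X₀ I E) n Y I κ →
        twistedReflexiveClass C (fun n X₀ I E => P n X₀ I E ∨ bfSingleAdmissible n X₀ I E) n Y' I
          (fun q => complexBetti.map e.hom (2 * q) (κ q)) :=
  twistedReflexiveClass_respectsIso_of_adm C _ (or_bfSingleAdmissible_pullback_of_schemeIso hP)

end Doors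

end Literature.AlgebraicGeometry.HodgeTheory

end
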